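import Summits.NavierStokesRegularity.NavierStokesRegularity.Theorems.LerayQuarterDissipationFiniteDissipationLiouvilleDssFactors
import Summits.NavierStokesRegularity.NavierStokesRegularity.Theorems.ClockStretchingLawClockCeilingOpenSetVorticityLiouville
import Literature.Analysis.FluidPDE.TypeIAncientMildRescale
import HarnessLib

/-!
# Crux `FiniteDissipationLiouville` (stmt-NavierStokesRegularity-22144): UNIQUE CONTINUATION OF
# DISCRETE SELF-SIMILARITY, and the RETURN TIMES of the scaling orbit of a finite-dissipation
# Type-I singularity — one short almost-return forces regularity

Theorems file of route `LerayQuarterDissipation` (lead prover g13; `--supports` the crux; portrait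
facts for the registered stub `stub_envelopeCriticalLiouville` of skeleton v26/v27). Navier–Stokes
regularity is NOT proved by anything here; no summit is. `𝒟_{C,K}` = Type-I ancient mild fields
in the KNSS gauge (`IsTypeIAncientMild C`) with the quarter-rate dissipation law
`∫‖∇W(s)‖² ≤ K/√(−s)`; the scaling orbit is `σ ↦ W_{e^σ}`, `W_μ(t,x) = μ W(μ²t, μx)`
(`nsRescale μ W`); «past-`μ`-DSS» means `μ • W (μ²t) (μ•x) = W t x` for all `t < 0`.

* `pastDss_of_eventually_eq` — **DISCRETE SELF-SIMILARITY IS A UNIQUE-CONTINUATION PROPERTY.** A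
  member of the Type-I ancient mild class which coincides with its `μ`-rescaling on a
  neighbourhood of ONE point of the open past is `μ`-DSS on the whole past: both fields are
  members (`IsTypeIAncientMild.nsRescale`), hence jointly real-analytic on the connected slab
  `(−∞,0) × ℝ³` (tree `openSetLiouville_analyticOnNhd_uncurry`, Lemarié-Rieusset 2016 Thm 9.12
  through the proved local analyticity of Oseen's scheme), and the identity theorem applies.
  Box form `pastDss_of_eqOn_box`.
* `exists_threshold_localDss` — with lead g6's uniform threshold `λ₀(C,K) > 1`
  (`exists_pastDss_threshold_unif`): a member of `𝒟_{C,K}` that is LOCALLY `μ`-DSS near one point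
  for some `1 < μ < λ₀` is regular at the apex. `eq_zero_of_localDss_incommensurable`: two local
  DSS germs (possibly at different points) with incommensurable factors kill a member (lead g7's
  factor group). `eq_zero_of_localDss_interval`: locally `μ`-DSS near one point for every `μ` in
  an interval `(1, 1+η)` — local self-similarity — kills a member.
* `tendsto_apply_of_tendsto` — evaluation at moving points under the slab-piece convergence of
  KNSS compactness (the argument inside lead g6's `pastDss_of_tendsto`, made reusable).
* `almostReturn_leaf` — **ONE SHORT ALMOST-RETURN FORCES REGULARITY.** For `1 < μ₁ ≤ μ₂ < λ₀` and
  every window `R > 1` there is `δ = δ(C,K,μ₁,μ₂,R) > 0` such that a member of `𝒟_{C,K}` with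
  `‖μ W(μ²s, μy) − W(s,y)‖ ≤ δ` on `[−R², −R⁻²] × B̄(0,R)` for SOME `μ ∈ [μ₁, μ₂]` is regular
  (KNSS compactness across members `Compactness.seqLimit` + Bolzano on `[μ₁,μ₂]` + persistence of
  the singularity + the law of the limit; the limit is exactly `μ`-DSS on the window, hence on the
  past by unique continuation, contradicting the threshold).
* `returnTime_floor_of_singular` — PORTRAIT: **a finite-dissipation Type-I singularity never
  returns `δ`-close to itself at a short lag**: for every singular member of `𝒟_{C,K}` (DSS or
  wandering; in particular every critical element, which IS uniformly scaling-recurrent), every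
  `μ ∈ [μ₁, μ₂] ⊂ (1, λ₀)` and every window, `‖μ W(μ²s, μy) − W(s,y)‖ > δ` somewhere on the
  window — the return-time spectrum of the scaling orbit on every window is bounded below by
  `λ₀(C,K)` in the factor, exactly as the least factor `λ_* ≥ λ₀` of the DSS members (lead g6/g7),
  now for almost-periods. The log-scale form, the SHARP small-lag form `> κ log μ` and the
  bookkeeping are in the sequel `…ReturnTimesSharp`.

Nearest in-tree antecedent (acknowledged, different class and hypothesis): the sister cruxes
stmt-4052/1589 (`fastApRemoval_box`, `fr_fastRecurrenceRemoval_compact`: in the Albritton–Barker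
suitable-weak class with `L³(Q₁)` distances, RELATIVELY DENSE short returns are removable;
`rdss_of_almostPeriodsInWindow`: almost periods of the WHOLE orbit in one lag-window force DSS
a.e.). Here ONE return suffices, in the finite-dissipation class, by analyticity + the uniform
exact-DSS threshold. HONEST FRAMING: `λ₀`, `δ` come from compactness (ineffective); nothing is
removed for lags `≥ log λ₀`; the crux stays blocked on `∀ c > 1, TypeIDSSLiouville c` (NECESSARY,
`…Hardness`). presearch (corpus hybrid+vec, galaxy all, 2026-08-28): no local-to-global DSS or
short-almost-period exclusion for backward Navier–Stokes profiles in print beyond Chae–Wolf's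
exact near-one window.

References: Koch–Nadirashvili–Seregin–Šverák, Acta Math. 203 (2009) = arXiv:0709.3599, §4;
Chae–Wolf, arXiv:1610.09464, Thm 1.3; Tsai, ARMA 143 (1998), Thm 1; Lemarié-Rieusset, *The
Navier–Stokes Problem in the 21st Century* (2016), Thm 9.12; Pineau–Vicol 2026 (breathers).
-/

noncomputable section

-- the summit and its single sub-problem share the name (CONVENTIONS §1), as in every Theorems file
set_option linter.dupNamespace false

namespace Summit.NavierStokesRegularity.NavierStokesRegularity.Theorems.FiniteDissipationLiouville.ReturnTimes

open MeasureTheory Set Filter Topology Metric Function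
open Literature.Analysis Literature.Analysis.FluidPDE
open Summit.NavierStokesRegularity.NavierStokesRegularity.Theorems.FiniteDissipationLiouville
open Summit.NavierStokesRegularity.NavierStokesRegularity.Theorems.FiniteDissipationLiouville.Birth
open scoped ENNReal NNReal

/-! ### Unique continuation of discrete self-similarity -/

/-- **Discrete self-similarity is a unique-continuation property.** If a Type-I ancient mild
field `W` (KNSS gauge) agrees with its `μ`-rescaling `μ W(μ²t, μx)` (`μ > 0`) on a neighbourhood
of one point `p` of the open past (`p.1 < 0`), then `W` is `μ`-DSS on the whole past. Both
fields are class members, hence jointly real-analytic on the preconnected slab `(−∞,0) × ℝ³`;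
identity theorem. [cite: LemarieRieusset2016, Thm. 9.12 (PDF p. 260)] -/
theorem pastDss_of_eventually_eq {C μ : ℝ}
    {W : ℝ → EuclideanSpace ℝ (Fin 3) → EuclideanSpace ℝ (Fin 3)} (hW : IsTypeIAncientMild C W)
    (hμ : 0 < μ) {p : ℝ × EuclideanSpace ℝ (Fin 3)} (hp : p.1 < 0)
    (h : ∀ᶠ z in 𝓝 p, μ • W (μ ^ 2 * z.1) (μ • z.2) = W z.1 z.2) :
    ∀ t : ℝ, t < 0 → ∀ x, μ • W (μ ^ 2 * t) (μ • x) = W t x := by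
  have hU : IsPreconnected (Iio (0 : ℝ) ×ˢ (univ : Set (EuclideanSpace ℝ (Fin 3)))) :=
    ((convex_Iio (0 : ℝ)).prod convex_univ).isPreconnected
  have hf : AnalyticOnNhd ℝ (uncurry (nsRescale μ W))
      (Iio (0 : ℝ) ×ˢ (univ : Set (EuclideanSpace ℝ (Fin 3)))) :=
    openSetLiouville_analyticOnNhd_uncurry (hW.nsRescale hμ)
  have hg : AnalyticOnNhd ℝ (uncurry W) (Iio (0 : ℝ) ×ˢ (univ : Set (EuclideanSpace ℝ (Fin 3)))) :=
    openSetLiouville_analyticOnNhd_uncurry hW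
  have hfg : uncurry (nsRescale μ W) =ᶠ[𝓝 p] uncurry W :=
    h.mono fun z hz => by simpa [uncurry, nsRescale_apply] using hz
  have heq := hf.eqOn_of_preconnected_of_eventuallyEq hg hU ⟨hp, mem_univ _⟩ hfg
  intro t ht x
  have := heq (mk_mem_prod ht (mem_univ x))
  simpa [uncurry, nsRescale_apply] using this

/-- **Box form**: agreement with the `μ`-rescaling on an open box `(a,b) × B(x₀,ρ)` of the open
past (`a < b ≤ 0`, `ρ > 0`) forces `μ`-DSS on the whole past. -/
theorem pastDss_of_eqOn_box {C μ : ℝ}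
    {W : ℝ → EuclideanSpace ℝ (Fin 3) → EuclideanSpace ℝ (Fin 3)} (hW : IsTypeIAncientMild C W)
    (hμ : 0 < μ) {a b : ℝ} (hab : a < b) (hb : b ≤ 0) {x₀ : EuclideanSpace ℝ (Fin 3)} {ρ : ℝ}
    (hρ : 0 < ρ)
    (h : ∀ s ∈ Ioo a b, ∀ y ∈ ball x₀ ρ, μ • W (μ ^ 2 * s) (μ • y) = W s y) :
    ∀ t : ℝ, t < 0 → ∀ x, μ • W (μ ^ 2 * t) (μ • x) = W t x := by
  set p : ℝ × EuclideanSpace ℝ (Fin 3) := ((a + b) / 2, x₀) with hp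
  have hp1 : p.1 < 0 := by show (a + b) / 2 < 0; linarith
  have hbox : Ioo a b ×ˢ ball x₀ ρ ∈ 𝓝 p :=
    prod_mem_nhds (Ioo_mem_nhds (by linarith) (by linarith)) (ball_mem_nhds _ hρ)
  exact pastDss_of_eventually_eq hW hμ hp1
    (Filter.eventually_of_mem hbox fun z hz => h z.1 hz.1 z.2 hz.2)

/-- **Local DSS below the uniform threshold forces regularity.** For all `C, K` there is
`λ₀ = λ₀(C,K) > 1` (lead g6's uniform near-one threshold) such that a member of `𝒟_{C,K}` which
agrees with its `μ`-rescaling near ONE point of the open past, for some `1 < μ < λ₀`, is not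
singular at the apex. [cite: ChaeWolf2017RemovingDSS, Thm. 1.3 (arXiv p. 3)] -/
theorem exists_threshold_localDss (C K : ℝ) : ∃ lam₀ : ℝ, 1 < lam₀ ∧
    ∀ (W : ℝ → EuclideanSpace ℝ (Fin 3) → EuclideanSpace ℝ (Fin 3)),
      IsTypeIAncientMild C W →
      (∀ s : ℝ, s < 0 → ∫⁻ x, ‖fderiv ℝ (W s) x‖ₑ ^ 2 ≤ ENNReal.ofReal (K / Real.sqrt (-s))) →
      ∀ μ : ℝ, 1 < μ → μ < lam₀ → ∀ p : ℝ × EuclideanSpace ℝ (Fin 3), p.1 < 0 →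
      (∀ᶠ z in 𝓝 p, μ • W (μ ^ 2 * z.1) (μ • z.2) = W z.1 z.2) →
      ¬ (∀ r > 0, ∀ M : ℝ, ∃ t ∈ Set.Ioo (-(r ^ 2)) (0 : ℝ),
          ∃ x ∈ Metric.ball (0 : EuclideanSpace ℝ (Fin 3)) r, M < ‖W t x‖) := by
  obtain ⟨lam₀, h1, h⟩ := exists_pastDss_threshold_unif C K
  exact ⟨lam₀, h1, fun W hW hlaw μ hμ hμl p hp hloc =>
    h W hW hlaw μ hμ hμl (pastDss_of_eventually_eq hW (one_pos.trans hμ) hp hloc)⟩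

/-- **Two local DSS germs with incommensurable factors kill a member** (no law needed): if `W`
agrees with its `c`-rescaling near a point `p` and with its `d`-rescaling near a point `q` of the
open past, `c, d > 1`, `log c / log d ∉ ℚ`, then `W ≡ 0` on the past (unique continuation + lead
g7's factor group `eq_zero_of_pastDss_incommensurable`). -/
theorem eq_zero_of_localDss_incommensurable {C c d : ℝ}
    {W : ℝ → EuclideanSpace ℝ (Fin 3) → EuclideanSpace ℝ (Fin 3)} (hW : IsTypeIAncientMild C W)
    (hc : 1 < c) (hd : 1 < d) (hirr : Irrational (Real.log c / Real.log d))
    {p q : ℝ × EuclideanSpace ℝ (Fin 3)} (hp : p.1 < 0) (hq : q.1 < 0)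
    (hcW : ∀ᶠ z in 𝓝 p, c • W (c ^ 2 * z.1) (c • z.2) = W z.1 z.2)
    (hdW : ∀ᶠ z in 𝓝 q, d • W (d ^ 2 * z.1) (d • z.2) = W z.1 z.2) :
    ∀ t < 0, ∀ x, W t x = 0 :=
  eq_zero_of_pastDss_incommensurable hW hc hd hirr
    (pastDss_of_eventually_eq hW (one_pos.trans hc) hp hcW)
    (pastDss_of_eventually_eq hW (one_pos.trans hd) hq hdW)

/-- **Local self-similarity kills a member**: if near ONE point of the open past `W` agrees with
its `μ`-rescaling for EVERY `μ` in an interval `(1, 1+η)`, then `W ≡ 0` on the past (unique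
continuation gives an interval of past-DSS factors; by lead g7's trichotomy the factors of a
nonzero member are `{1}` or a discrete group `λ_*^ℤ`). [cite: Tsai1998, Thm. 1] -/
theorem eq_zero_of_localDss_interval {C : ℝ}
    {W : ℝ → EuclideanSpace ℝ (Fin 3) → EuclideanSpace ℝ (Fin 3)} (hW : IsTypeIAncientMild C W)
    {η : ℝ} (hη : 0 < η) {p : ℝ × EuclideanSpace ℝ (Fin 3)} (hp : p.1 < 0)
    (h : ∀ μ ∈ Ioo (1 : ℝ) (1 + η), ∀ᶠ z in 𝓝 p, μ • W (μ ^ 2 * z.1) (μ • z.2) = W z.1 z.2) :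
    ∀ t < 0, ∀ x, W t x = 0 := by
  have hfac : ∀ μ ∈ Ioo (1 : ℝ) (1 + η), ∀ t : ℝ, t < 0 → ∀ x,
      μ • W (μ ^ 2 * t) (μ • x) = W t x := fun μ hμ =>
    pastDss_of_eventually_eq hW (one_pos.trans hμ.1) hp (h μ hμ)
  rcases pastDss_factor_trichotomy hW with h0 | h1 | ⟨lam, hlam, hgen⟩
  · exact h0
  · exfalso
    have hμ : (1 + η / 2 : ℝ) ∈ Ioo (1 : ℝ) (1 + η) := ⟨by linarith, by linarith⟩
    have := h1 (1 + η / 2) (by linarith) (hfac _ hμ)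
    linarith
  · exfalso
    -- `μ := min (1 + η/2) (√λ_*)` is a factor in `(1, λ_*)`, impossible for a power `λ_*^k`
    set μ : ℝ := min (1 + η / 2) (Real.sqrt lam) with hμdef
    have hsq1 : 1 < Real.sqrt lam := by
      rw [show (1 : ℝ) = Real.sqrt 1 by simp]
      exact Real.sqrt_lt_sqrt (by norm_num) hlam
    have hμ1 : 1 < μ := lt_min (by linarith) hsq1
    have hμη : μ < 1 + η := (min_le_left _ _).trans_lt (by linarith)
    have hμlam : μ < lam := by
      have hsl : Real.sqrt lam < lam := by
        have hl0 : 0 < lam := one_pos.trans hlam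
        have h2 : Real.sqrt lam * 1 < Real.sqrt lam * Real.sqrt lam :=
          mul_lt_mul_of_pos_left hsq1 (one_pos.trans hsq1)
        rwa [mul_one, Real.mul_self_sqrt hl0.le] at h2
      exact (min_le_right _ _).trans_lt hsl
    obtain ⟨k, hk⟩ := (hgen μ (one_pos.trans hμ1)).1 (hfac μ ⟨hμ1, hμη⟩)
    rcases le_or_gt k 0 with hk0 | hk0
    · have : μ ≤ 1 := by rw [hk]; exact zpow_le_one_of_nonpos₀ hlam.le hk0
      linarith
    · have h1k : (1 : ℤ) ≤ k := hk0
      have : lam ≤ μ := by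
        rw [hk]
        calc lam = lam ^ (1 : ℤ) := (zpow_one lam).symm
          _ ≤ lam ^ k := zpow_le_zpow_right₀ hlam.le h1k
      linarith

/-! ### Convergence at moving points under KNSS compactness -/

/-- **Evaluation at moving points.** If `w j → W` uniformly on every slab piece
`[−(n+2), −1/(n+2)] × B̄(0, n+2)` and `W` is continuous on the open slab, then
`w j (p j) → W(q)` whenever `p j → q` with `q.1 < 0`. (The argument inside lead g6's
`pastDss_of_tendsto`, made reusable.) -/
theorem tendsto_apply_of_tendsto
    {w : ℕ → ℝ → EuclideanSpace ℝ (Fin 3) → EuclideanSpace ℝ (Fin 3)}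
    {W : ℝ → EuclideanSpace ℝ (Fin 3) → EuclideanSpace ℝ (Fin 3)}
    (hWc : ContinuousOn (uncurry W) (Iio (0 : ℝ) ×ˢ univ))
    (hunif : ∀ n : ℕ, TendstoUniformlyOn (fun j z => w j z.1 z.2) (fun z => W z.1 z.2)
      atTop (Icc (-((n : ℝ) + 2)) (-(1 / ((n : ℝ) + 2))) ×ˢ
        closedBall (0 : EuclideanSpace ℝ (Fin 3)) ((n : ℝ) + 2)))
    {p : ℕ → ℝ × EuclideanSpace ℝ (Fin 3)} {q : ℝ × EuclideanSpace ℝ (Fin 3)} (hq : q.1 < 0)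
    (hp : Tendsto p atTop (𝓝 q)) :
    Tendsto (fun j => w j (p j).1 (p j).2) atTop (𝓝 (W q.1 q.2)) := by
  -- adapted from Theorems/…DssUniformThreshold.lean (`pastDss_of_tendsto`)
  obtain ⟨n, hn⟩ : ∃ n : ℕ, -((n : ℝ) + 2) < 2 * q.1 ∧ q.1 / 2 < -(1 / ((n : ℝ) + 2)) ∧
      ‖q.2‖ + 1 < (n : ℝ) + 2 := by
    obtain ⟨n₁, hn₁⟩ := exists_nat_gt (-(2 * q.1))
    obtain ⟨n₂, hn₂⟩ := exists_nat_gt (2 / -q.1)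
    obtain ⟨n₃, hn₃⟩ := exists_nat_gt (‖q.2‖ + 1)
    refine ⟨n₁ + n₂ + n₃, ?_, ?_, ?_⟩
    · push_cast; linarith [Nat.cast_nonneg (α := ℝ) n₂, Nat.cast_nonneg (α := ℝ) n₃]
    · have hpos : 0 < -q.1 := by linarith
      have h2 : 2 / -q.1 < (n₁ : ℝ) + n₂ + n₃ + 2 := by
        linarith [Nat.cast_nonneg (α := ℝ) n₁, Nat.cast_nonneg (α := ℝ) n₃]
      rw [div_lt_iff₀ hpos] at h2
      have hN : (0 : ℝ) < (n₁ : ℝ) + n₂ + n₃ + 2 := by positivity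
      have h3 : 1 / ((n₁ : ℝ) + n₂ + n₃ + 2) < -q.1 / 2 := by
        rw [div_lt_iff₀ hN]; linarith
      push_cast
      linarith
    · push_cast; linarith [Nat.cast_nonneg (α := ℝ) n₁, Nat.cast_nonneg (α := ℝ) n₂]
  set S : Set (ℝ × EuclideanSpace ℝ (Fin 3)) :=
    Icc (-((n : ℝ) + 2)) (-(1 / ((n : ℝ) + 2))) ×ˢ
      closedBall (0 : EuclideanSpace ℝ (Fin 3)) ((n : ℝ) + 2) with hS
  have hbox : Ioo (2 * q.1) (q.1 / 2) ×ˢ ball q.2 1 ∈ 𝓝 q := by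
    have : q = (q.1, q.2) := rfl
    rw [this]
    exact prod_mem_nhds (Ioo_mem_nhds (by linarith) (by linarith)) (ball_mem_nhds _ one_pos)
  have hboxS : Ioo (2 * q.1) (q.1 / 2) ×ˢ ball q.2 1 ⊆ S := by
    rintro ⟨s, y⟩ ⟨hs, hy⟩
    refine ⟨⟨by linarith [hs.1], by linarith [hs.2]⟩, ?_⟩
    rw [mem_closedBall, dist_zero_right]
    rw [mem_ball, dist_eq_norm] at hy
    have : ‖y‖ ≤ ‖y - q.2‖ + ‖q.2‖ := by
      calc ‖y‖ = ‖(y - q.2) + q.2‖ := by rw [sub_add_cancel]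
        _ ≤ ‖y - q.2‖ + ‖q.2‖ := norm_add_le _ _
    linarith
  have hev_mem : ∀ᶠ j in atTop, p j ∈ S :=
    (hp.eventually (eventually_mem_set.2 hbox)).mono fun j hj => hboxS hj
  have hWq : ContinuousAt (uncurry W) q :=
    hWc.continuousAt ((isOpen_Iio.prod isOpen_univ).mem_nhds ⟨hq, mem_univ _⟩)
  rw [Metric.tendsto_atTop]
  intro ε hε
  have hu := (Metric.tendstoUniformlyOn_iff.1 (hunif n)) (ε / 2) (half_pos hε)
  have hc := (Metric.tendsto_nhds.1 (hWq.tendsto.comp hp)) (ε / 2) (half_pos hε)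
  obtain ⟨N, hN⟩ := eventually_atTop.1 ((hu.and hc).and hev_mem)
  refine ⟨N, fun j hj => ?_⟩
  obtain ⟨⟨h1, h2⟩, h3⟩ := hN j hj
  have h1' := h1 _ h3
  simp only [Function.comp_apply] at h2
  have h2' : dist (W (p j).1 (p j).2) (W q.1 q.2) < ε / 2 := h2
  calc dist (w j (p j).1 (p j).2) (W q.1 q.2)
      ≤ dist (w j (p j).1 (p j).2) (W (p j).1 (p j).2) + dist (W (p j).1 (p j).2) (W q.1 q.2) :=
        dist_triangle _ _ _
    _ < ε / 2 + ε / 2 := add_lt_add (by rw [dist_comm]; exact h1') h2'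
    _ = ε := by ring


/-! ### One short almost-return forces regularity -/

/-- **ONE SHORT ALMOST-RETURN OF THE SCALING ORBIT FORCES REGULARITY.** For all `C, K` there is
`λ₀ > 1` (lead g6's uniform threshold) such that for all `1 < μ₁ ≤ μ₂ < λ₀` and every window
`R > 1` there is `δ > 0` with: a member of `𝒟_{C,K}` satisfying
`‖μ W(μ²s, μy) − W(s,y)‖ ≤ δ` for `s ∈ [−R², −R⁻²]`, `‖y‖ ≤ R`, for SOME `μ ∈ [μ₁, μ₂]`, is not
singular at the apex. Proof: otherwise singular members with defects `→ 0` exist; Bolzano on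
`[μ₁, μ₂]` and KNSS compactness across members give a singular limit member of `𝒟_{C,K}` that is
EXACTLY `μ`-DSS on the window, hence on the past by unique continuation — contradicting the
threshold. [cite: KochNadirashviliSereginSverak2009, §4 (arXiv:0709.3599 p. 8)] -/
theorem almostReturn_leaf (C K : ℝ) : ∃ lam₀ : ℝ, 1 < lam₀ ∧
    ∀ μ₁ μ₂ : ℝ, 1 < μ₁ → μ₁ ≤ μ₂ → μ₂ < lam₀ → ∀ R : ℝ, 1 < R → ∃ δ : ℝ, 0 < δ ∧
      ∀ (W : ℝ → EuclideanSpace ℝ (Fin 3) → EuclideanSpace ℝ (Fin 3)),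
        IsTypeIAncientMild C W →
        (∀ s : ℝ, s < 0 → ∫⁻ x, ‖fderiv ℝ (W s) x‖ₑ ^ 2 ≤ ENNReal.ofReal (K / Real.sqrt (-s))) →
        ∀ μ ∈ Icc μ₁ μ₂,
        (∀ s ∈ Icc (-(R ^ 2)) (-(R⁻¹) ^ 2), ∀ y ∈ closedBall (0 : EuclideanSpace ℝ (Fin 3)) R,
            ‖μ • W (μ ^ 2 * s) (μ • y) - W s y‖ ≤ δ) →
        ¬ (∀ r > 0, ∀ M : ℝ, ∃ t ∈ Set.Ioo (-(r ^ 2)) (0 : ℝ),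
            ∃ x ∈ Metric.ball (0 : EuclideanSpace ℝ (Fin 3)) r, M < ‖W t x‖) := by
  obtain ⟨lam₀, h1, hthr⟩ := exists_pastDss_threshold_unif C K
  refine ⟨lam₀, h1, fun μ₁ μ₂ hμ₁ hμ12 hμ₂ R hR => ?_⟩
  by_contra hcon
  push Not at hcon
  -- ### singular members with window defects `≤ 1/(k+1)` at factors `μ_k ∈ [μ₁, μ₂]`
  have hseq : ∀ k : ℕ, ∃ (W : ℝ → EuclideanSpace ℝ (Fin 3) → EuclideanSpace ℝ (Fin 3)) (μ : ℝ),
      IsTypeIAncientMild C W ∧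
      (∀ s : ℝ, s < 0 → ∫⁻ x, ‖fderiv ℝ (W s) x‖ₑ ^ 2 ≤ ENNReal.ofReal (K / Real.sqrt (-s))) ∧
      μ ∈ Icc μ₁ μ₂ ∧
      (∀ s ∈ Icc (-(R ^ 2)) (-(R⁻¹) ^ 2), ∀ y ∈ closedBall (0 : EuclideanSpace ℝ (Fin 3)) R,
          ‖μ • W (μ ^ 2 * s) (μ • y) - W s y‖ ≤ 1 / ((k : ℝ) + 1)) ∧
      (∀ r > 0, ∀ M : ℝ, ∃ t ∈ Set.Ioo (-(r ^ 2)) (0 : ℝ),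
          ∃ x ∈ Metric.ball (0 : EuclideanSpace ℝ (Fin 3)) r, M < ‖W t x‖) := by
    intro k
    obtain ⟨W, hW, hlaw, μ, hμ, hdef, hsing⟩ := hcon (1 / ((k : ℝ) + 1)) (by positivity)
    exact ⟨W, μ, hW, hlaw, hμ, hdef, hsing⟩
  choose W μs hW hlaw hμs hdef hsing using hseq
  -- ### Bolzano on `[μ₁, μ₂]`, then KNSS compactness across members
  obtain ⟨μ, hμmem, φ, hφ, hμlim⟩ := isCompact_Icc.tendsto_subseq hμs
  obtain ⟨ψ, hψ, V, hV, hunif, hpt, hgrad⟩ := Compactness.seqLimit (fun j => hW (φ j))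
  have hψt : Tendsto ψ atTop atTop := hψ.tendsto_atTop
  have hμlim' : Tendsto (fun j => μs (φ (ψ j))) atTop (𝓝 μ) := hμlim.comp hψt
  have hVlaw : ∀ s : ℝ, s < 0 →
      ∫⁻ x, ‖fderiv ℝ (V s) x‖ₑ ^ 2 ≤ ENNReal.ofReal (K / Real.sqrt (-s)) :=
    Compactness.law_of_seqLimit (Kinf := K) (Kk := fun _ => K) (w := fun j => W (φ j)) hψt
      (fun j => hlaw (φ j)) (fun ε hε => Eventually.of_forall fun _ => by linarith) hgrad
  have hVsing := Compactness.persistent_singularity_seq (w := fun j => W (φ (ψ j)))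
    (fun j => hW _) (fun j => hlaw _) (fun j => hsing _) hV hunif
  have hμ0 : 0 < μ := by linarith [hμmem.1]
  -- ### the limit is EXACTLY `μ`-DSS on the window
  have hwin : ∀ s ∈ Icc (-(R ^ 2)) (-(R⁻¹) ^ 2), ∀ y ∈ closedBall (0 : EuclideanSpace ℝ (Fin 3)) R,
      μ • V (μ ^ 2 * s) (μ • y) = V s y := by
    intro s hs y hy
    have hs0 : s < 0 := by
      have : 0 < (R⁻¹) ^ 2 := by positivity
      linarith [hs.2]
    have hq : ((μ ^ 2 * s, μ • y) : ℝ × EuclideanSpace ℝ (Fin 3)).1 < 0 :=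
      mul_neg_of_pos_of_neg (by positivity) hs0
    have hpj : Tendsto (fun j => ((μs (φ (ψ j)) ^ 2 * s, μs (φ (ψ j)) • y) :
        ℝ × EuclideanSpace ℝ (Fin 3))) atTop (𝓝 (μ ^ 2 * s, μ • y)) :=
      ((hμlim'.pow 2).mul_const s).prodMk_nhds (hμlim'.smul_const y)
    have hA : Tendsto (fun j => W (φ (ψ j)) (μs (φ (ψ j)) ^ 2 * s) (μs (φ (ψ j)) • y)) atTop
        (𝓝 (V (μ ^ 2 * s) (μ • y))) :=
      tendsto_apply_of_tendsto (w := fun j => W (φ (ψ j))) hV.continuousOn_uncurry hunif hq hpj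
    have hB : Tendsto (fun j => W (φ (ψ j)) s y) atTop (𝓝 (V s y)) := hpt s hs0 y
    have hdiff : Tendsto (fun j => ‖μs (φ (ψ j)) • W (φ (ψ j)) (μs (φ (ψ j)) ^ 2 * s)
        (μs (φ (ψ j)) • y) - W (φ (ψ j)) s y‖) atTop (𝓝 ‖μ • V (μ ^ 2 * s) (μ • y) - V s y‖) :=
      ((hμlim'.smul hA).sub hB).norm
    have hbound : ∀ j, ‖μs (φ (ψ j)) • W (φ (ψ j)) (μs (φ (ψ j)) ^ 2 * s) (μs (φ (ψ j)) • y) -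
        W (φ (ψ j)) s y‖ ≤ 1 / ((j : ℝ) + 1) := by
      intro j
      refine (hdef (φ (ψ j)) s hs y hy).trans ?_
      have hj : (j : ℝ) ≤ (φ (ψ j) : ℝ) := by exact_mod_cast (hφ.comp hψ).id_le j
      exact one_div_le_one_div_of_le (by positivity) (by linarith)
    have hle : ‖μ • V (μ ^ 2 * s) (μ • y) - V s y‖ ≤ 0 :=
      le_of_tendsto_of_tendsto' hdiff tendsto_one_div_add_atTop_nhds_zero_nat hbound
    exact sub_eq_zero.1 (norm_eq_zero.1 (le_antisymm hle (norm_nonneg _)))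
  -- ### hence on the whole past (unique continuation), contradicting the threshold
  have hpast : ∀ t : ℝ, t < 0 → ∀ x, μ • V (μ ^ 2 * t) (μ • x) = V t x := by
    have hR0 : 0 < R := zero_lt_one.trans hR
    have hab : -(R ^ 2) < -(R⁻¹) ^ 2 := by
      have hR1 : R⁻¹ < 1 := inv_lt_one_of_one_lt₀ hR
      have hRi : 0 < R⁻¹ := by positivity
      nlinarith
    have hb : -(R⁻¹) ^ 2 ≤ (0 : ℝ) := by
      have : 0 ≤ (R⁻¹) ^ 2 := by positivity
      linarith
    refine pastDss_of_eqOn_box hV hμ0 hab hb (x₀ := 0) hR0 ?_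
    intro s hs y hy
    exact hwin s (Ioo_subset_Icc_self hs) y (ball_subset_closedBall hy)
  exact hthr V hV hVlaw μ (by linarith [hμmem.1]) (by linarith [hμmem.2]) hpast hVsing

/-- **PORTRAIT: no short almost-returns.** For every SINGULAR member of `𝒟_{C,K}` — DSS or
wandering, in particular every critical element — every factor `μ ∈ [μ₁, μ₂] ⊂ (1, λ₀)` and every
window: `‖μ W(μ²s, μy) − W(s,y)‖ > δ(C,K,μ₁,μ₂,R)` somewhere on `[−R², −R⁻²] × B̄(0,R)`. -/
theorem returnTime_floor_of_singular (C K : ℝ) : ∃ lam₀ : ℝ, 1 < lam₀ ∧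
    ∀ μ₁ μ₂ : ℝ, 1 < μ₁ → μ₁ ≤ μ₂ → μ₂ < lam₀ → ∀ R : ℝ, 1 < R → ∃ δ : ℝ, 0 < δ ∧
      ∀ (W : ℝ → EuclideanSpace ℝ (Fin 3) → EuclideanSpace ℝ (Fin 3)),
        IsTypeIAncientMild C W →
        (∀ s : ℝ, s < 0 → ∫⁻ x, ‖fderiv ℝ (W s) x‖ₑ ^ 2 ≤ ENNReal.ofReal (K / Real.sqrt (-s))) →
        (∀ r > 0, ∀ M : ℝ, ∃ t ∈ Set.Ioo (-(r ^ 2)) (0 : ℝ),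
            ∃ x ∈ Metric.ball (0 : EuclideanSpace ℝ (Fin 3)) r, M < ‖W t x‖) →
        ∀ μ ∈ Icc μ₁ μ₂, ∃ s ∈ Icc (-(R ^ 2)) (-(R⁻¹) ^ 2),
          ∃ y ∈ closedBall (0 : EuclideanSpace ℝ (Fin 3)) R,
            δ < ‖μ • W (μ ^ 2 * s) (μ • y) - W s y‖ := by
  obtain ⟨lam₀, h1, h⟩ := almostReturn_leaf C K
  refine ⟨lam₀, h1, fun μ₁ μ₂ hμ₁ hμ12 hμ₂ R hR => ?_⟩
  obtain ⟨δ, hδ, hreg⟩ := h μ₁ μ₂ hμ₁ hμ12 hμ₂ R hR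
  refine ⟨δ, hδ, fun W hW hlaw hsing μ hμ => ?_⟩
  by_contra hcon
  push Not at hcon
  exact hreg W hW hlaw μ hμ hcon hsing

end Summit.NavierStokesRegularity.NavierStokesRegularity.Theorems.FiniteDissipationLiouville.ReturnTimes

end
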